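import Literature.MathematicalPhysics.QuantumLattice.StaggeredOrderFromEvenBoxes
import HarnessLib

/-!
# Numeric site norms of nearest-neighbour Hubbard-type interactions; the fully numeric staggered-order certificate

The box windows of the variational principle (`FermionGibbsVariationalPrinciple`, `PeriodicGibbsVariationalPrinciple`, …) carry the SYMBOLIC
site norm `S = Σ_{X ∋ x} ‖Φ X‖` (`cellSiteNorm`). For the certified-numerics cells this file turns it into NUMBERS:

* §1 a generic bound: if `Φ X = 0` unless `X` is a singleton or a nearest-neighbour bond `{y, y + e_i}`, `‖Φ{y}‖ ≤ A` and
  `‖Φ{y, y+e_i}‖ ≤ B`, then `Σ_{X ⊆ T, x ∈ X} ‖Φ X‖ ≤ A + 2dB` for every region `T` and site `x` (`sum_norm_le_of_nearestNeighbour`).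
* §2 the staggered-field Hubbard model `hubbardStaggered d t U θ`: all other terms vanish, `‖Φ{y}‖ ≤ |U| + 2|θ₀| + 2|θ₁|`, `‖Φ{y,y+e_i}‖ ≤ 2|t|`
  (Koma–Tasaki bond norm), hence **`S_q(hubbardStaggered) ≤ |U| + 2|θ₀| + 2|θ₁| + 4d|t|`** for every superlattice `q` and range parameter `R`
  (`cellSiteNorm_hubbardStaggered_le`).
* §3 **THE FULLY NUMERIC STAGGERED-ORDER CERTIFICATE**: for every `(2ℤ)^d`-periodic equilibrium state of the zero-field Hubbard model
  (`β > 0`, `d ≥ 1`), every `δ > 0`, every even `N ≥ 1` and certified `ℓ₀ ≤ log Re Z_N(a,0)`, `log Re Z_N(a,δ) ≤ u₁`: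
  `|m_s(ω)| ≤ ((u₁ − ℓ₀) + |β|((N+2)^d − N^d)(2|U| + 4|a| + 2δ + 8d|t|)) / (N^d βδ)`
  (`abs_staggeredMagnetisation_le_numeric`) — every symbol on the right is a number the certifier controls.

Everything is PROVED; no definition, no named fact, no number of record.

## Tree / Mathlib search

REUSED: `hubbardStaggered`, `stagSign_eq_one_or`, `staggeredSpinInteraction_apply_singleton/_apply_eq_zero`, `IsPerVarEquilibrium.abs_staggeredMagnetisation_le_of_evenBoxes`
(`PeriodicSublatticeAndStaggeredTerms`, `StaggeredOrderFromEvenBoxes`); `hubbardFermionInteraction_apply_singleton/_apply_pair/_apply_eq_zero`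
(`HubbardFermionInteractionTerms`); `numberInteraction_apply_singleton/_apply_eq_zero`; `norm_hoppingTerm_le_two_mul` (`HubbardHoppingBondNormSharp`); `orb_inj`;
`norm_numberOp_le_one` (`FermionLiebRobinson`); `cellSiteNorm` (`PeriodicVariationalPressure`); `card_thicken_halfOpenBox_sdiff_le`
(`TranslationInvariantGroundStatesAreMeanEnergyMinimisers`); Mathlib `Finset.sum_ite_eq'`, `Finset.single_le_sum`.

## References

* T. Koma, H. Tasaki, Phys. Rev. Lett. 68 (1992) 3248, remark after eq. (11) (the bond norm `2|t|`).
* R. B. Israel, *Convexity in the Theory of Lattice Gases* (1979), Lemma II.3.1 (surface terms are controlled by the interaction norm).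
-/

noncomputable section

open scoped ComplexOrder BigOperators Matrix.Norms.L2Operator
open Finset Filter Topology

namespace Literature.MathematicalPhysics.QuantumLattice

open Matrix HubbardWave0 Literature.Probability.LatticeModels ThermodynamicLimit

variable {d : ℕ}

/-! ### §1. Site sums of nearest-neighbour interactions -/

/-- **Site norm of a nearest-neighbour interaction**: if `Φ X = 0` unless `X` is a singleton or a bond `{y, y+e_i}`, `‖Φ{y}‖ ≤ A` and
`‖Φ{y, y+e_i}‖ ≤ B` (`A, B ≥ 0`), then `Σ_{X ⊆ T, x ∈ X} ‖Φ X‖ ≤ A + 2dB`. [cite: Israel1979, Lemma II.3.1] -/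
theorem sum_norm_le_of_nearestNeighbour {Ψ : FermionInteraction d} {A B : ℝ} (hA0 : 0 ≤ A) (hB0 : 0 ≤ B)
    (hzero : ∀ X : Finset (Site d), (∀ y : Site d, X ≠ {y}) → (∀ (y : Site d) (i : Fin d), X ≠ {y, y + unitVec i}) → Ψ.Φ X = 0)
    (hA : ∀ y : Site d, ‖Ψ.Φ {y}‖ ≤ A) (hB : ∀ (y : Site d) (i : Fin d), ‖Ψ.Φ {y, y + unitVec i}‖ ≤ B)
    (T : Finset (Site d)) (x : Site d) :
    ∑ X ∈ T.powerset with x ∈ X, ‖Ψ.Φ X‖ ≤ A + 2 * d * B := by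
  set F := T.powerset.filter (fun X => x ∈ X) with hF
  -- indicator sums: one candidate set contributes at most once
  have key : ∀ (X : Finset (Site d)) (S S' : Fin d → Finset (Site d)) (i : Fin d), (X = S i ∨ X = S' i) →
      B ≤ ∑ j : Fin d, ((if X = S j then B else 0) + (if X = S' j then B else 0)) := by
    intro X S S' i hXi
    have hnn : ∀ j ∈ (Finset.univ : Finset (Fin d)), 0 ≤ (if X = S j then B else 0) + (if X = S' j then B else 0) :=
      fun j _ => add_nonneg (by split_ifs <;> simp [hB0]) (by split_ifs <;> simp [hB0])
    refine le_trans ?_ (Finset.single_le_sum hnn (Finset.mem_univ i))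
    have h1 : 0 ≤ (if X = S i then B else 0) := by split_ifs <;> simp [hB0]
    have h2 : 0 ≤ (if X = S' i then B else 0) := by split_ifs <;> simp [hB0]
    rcases hXi with h | h
    · rw [if_pos h] at h1 ⊢
      linarith
    · rw [if_pos h] at h2 ⊢
      linarith
  -- pointwise majorant by indicators of the `1 + 2d` sets through `x` that can carry a term
  have hpt : ∀ X ∈ F, ‖Ψ.Φ X‖ ≤ (if X = {x} then A else 0) +
      ∑ i : Fin d, ((if X = {x, x + unitVec i} then B else 0) + (if X = {x - unitVec i, x - unitVec i + unitVec i} then B else 0)) := by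
    intro X hX
    have hxX : x ∈ X := (mem_filter.1 hX).2
    have hnn : 0 ≤ ∑ i : Fin d, ((if X = {x, x + unitVec i} then B else 0) +
        (if X = {x - unitVec i, x - unitVec i + unitVec i} then B else 0)) :=
      Finset.sum_nonneg fun i _ => add_nonneg (by split_ifs <;> simp [hB0]) (by split_ifs <;> simp [hB0])
    have hiA : 0 ≤ (if X = {x} then A else 0) := by split_ifs <;> simp [hA0]
    by_cases h1 : ∃ y : Site d, X = {y}
    · obtain ⟨y, rfl⟩ := h1
      rw [mem_singleton] at hxX
      subst hxX
      rw [if_pos rfl]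
      linarith [hA x]
    by_cases h2 : ∃ (y : Site d) (i : Fin d), X = {y, y + unitVec i}
    · obtain ⟨y, i, rfl⟩ := h2
      have hXB := hB y i
      rw [mem_insert, mem_singleton] at hxX
      rcases hxX with rfl | rfl
      · have hk := key {x, x + unitVec i} (fun j => {x, x + unitVec j}) (fun j => {x - unitVec j, x - unitVec j + unitVec j}) i (Or.inl rfl)
        linarith
      · have hk := key {y, y + unitVec i} (fun j => {y + unitVec i, y + unitVec i + unitVec j})
          (fun j => {y + unitVec i - unitVec j, y + unitVec i - unitVec j + unitVec j}) i (Or.inr (by rw [add_sub_cancel_right]))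
        linarith
    · push Not at h1 h2
      rw [hzero X h1 (fun y i => h2 y i), norm_zero]
      linarith
  refine (Finset.sum_le_sum hpt).trans ?_
  rw [Finset.sum_add_distrib, Finset.sum_comm]
  have h1 : ∑ X ∈ F, (if X = {x} then A else 0) ≤ A := by
    rw [Finset.sum_ite_eq']
    split_ifs <;> simp [hA0]
  have h2 : ∀ i : Fin d, ∑ X ∈ F, ((if X = {x, x + unitVec i} then B else 0) + (if X = {x - unitVec i, x - unitVec i + unitVec i} then B else 0)) ≤ 2 * B := by
    intro i
    rw [Finset.sum_add_distrib, Finset.sum_ite_eq', Finset.sum_ite_eq']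
    split_ifs <;> linarith
  calc ∑ X ∈ F, (if X = {x} then A else 0) +
        ∑ i : Fin d, ∑ X ∈ F, ((if X = {x, x + unitVec i} then B else 0) + (if X = {x - unitVec i, x - unitVec i + unitVec i} then B else 0))
      ≤ A + ∑ _i : Fin d, 2 * B := add_le_add h1 (Finset.sum_le_sum fun i _ => h2 i)
    _ = A + 2 * d * B := by rw [Finset.sum_const, Finset.card_univ, Fintype.card_fin, nsmul_eq_mul]; ring

/-! ### §2. The staggered-field Hubbard model: vanishing, on-site and bond norms, numeric site norm -/

section Staggered

variable (t U : ℝ) (θ : Fin 2 → ℝ)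

/-- All terms of `hubbardStaggered` off singletons and nearest-neighbour bonds vanish. [cite: arXiv9311033, §2 (the Hubbard Hamiltonian)] -/
theorem hubbardStaggered_apply_eq_zero {X : Finset (Site d)} (h1 : ∀ y : Site d, X ≠ {y}) (h2 : ∀ (y : Site d) (i : Fin d), X ≠ {y, y + unitVec i}) :
    (hubbardStaggered d t U θ).Φ X = 0 := by
  rw [hubbardStaggered, FermionInteraction.linearFamily_apply, Fin.sum_univ_two, hubbardFermionInteraction_apply_eq_zero t U h1 h2,
    Matrix.cons_val_zero, Matrix.cons_val_one, Matrix.cons_val_zero, numberInteraction_apply_eq_zero h1, staggeredSpinInteraction_apply_eq_zero h1,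
    smul_zero, smul_zero, add_zero, zero_add]

/-- The on-site term: `Φ{y} = U n↑n↓ + θ₀ (n↑ + n↓) + θ₁ (−1)^y (n↑ − n↓)`. [cite: arXiv9311033, §2 (the Hubbard Hamiltonian)] -/
theorem hubbardStaggered_apply_singleton (y : Site d) :
    (hubbardStaggered d t U θ).Φ {y} =
      (U : ℂ) • (nAt y (mem_singleton_self y) 0 * nAt y (mem_singleton_self y) 1) +
        ((((θ 0 : ℝ) : ℂ) • (nAt y (mem_singleton_self y) 0 + nAt y (mem_singleton_self y) 1)) +
          ((θ 1 : ℝ) : ℂ) • (((stagSign y : ℝ) : ℂ) • (nAt y (mem_singleton_self y) 0 - nAt y (mem_singleton_self y) 1))) := by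
  rw [hubbardStaggered, FermionInteraction.linearFamily_apply, Fin.sum_univ_two, hubbardFermionInteraction_apply_singleton,
    Matrix.cons_val_zero, Matrix.cons_val_one, Matrix.cons_val_zero, numberInteraction_apply_singleton,
    staggeredSpinInteraction_apply_singleton]

/-- **On-site norm**: `‖Φ{y}‖ ≤ |U| + 2|θ₀| + 2|θ₁|`. [cite: KomaTasakiPRL1992, eq. (11) remark] -/
theorem norm_hubbardStaggered_singleton_le (y : Site d) : ‖(hubbardStaggered d t U θ).Φ {y}‖ ≤ |U| + 2 * |θ 0| + 2 * |θ 1| := by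
  have hn : ∀ σ : Fin 2, ‖(nAt y (mem_singleton_self y) σ : FermionOp ({y} : Finset (Site d)))‖ ≤ 1 := fun σ => norm_numberOp_le_one _ _
  rw [hubbardStaggered_apply_singleton]
  set n0 : FermionOp ({y} : Finset (Site d)) := nAt y (mem_singleton_self y) 0 with hn0
  set n1 : FermionOp ({y} : Finset (Site d)) := nAt y (mem_singleton_self y) 1 with hn1
  have h0 : ‖n0‖ ≤ 1 := hn 0
  have h1' : ‖n1‖ ≤ 1 := hn 1
  have hA : ‖(U : ℂ) • (n0 * n1)‖ ≤ |U| := by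
    rw [norm_smul, Complex.norm_real, Real.norm_eq_abs]
    exact mul_le_of_le_one_right (abs_nonneg U) ((norm_mul_le _ _).trans (mul_le_one₀ h0 (norm_nonneg _) h1'))
  have hB : ‖((θ 0 : ℝ) : ℂ) • (n0 + n1)‖ ≤ 2 * |θ 0| := by
    rw [norm_smul, Complex.norm_real, Real.norm_eq_abs, mul_comm]
    exact mul_le_mul_of_nonneg_right ((norm_add_le _ _).trans (by linarith)) (abs_nonneg _)
  have hC : ‖((θ 1 : ℝ) : ℂ) • (((stagSign y : ℝ) : ℂ) • (n0 - n1))‖ ≤ 2 * |θ 1| := by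
    have hs : ‖((stagSign y : ℝ) : ℂ)‖ = 1 := by
      rw [Complex.norm_real, Real.norm_eq_abs]
      rcases stagSign_eq_one_or y with h | h <;> simp [h]
    rw [norm_smul, norm_smul, hs, one_mul, Complex.norm_real, Real.norm_eq_abs, mul_comm]
    exact mul_le_mul_of_nonneg_right ((norm_sub_le _ _).trans (by linarith)) (abs_nonneg _)
  have hBC := norm_add_le (((θ 0 : ℝ) : ℂ) • (n0 + n1)) (((θ 1 : ℝ) : ℂ) • (((stagSign y : ℝ) : ℂ) • (n0 - n1)))
  have hABC := norm_add_le ((U : ℂ) • (n0 * n1)) (((θ 0 : ℝ) : ℂ) • (n0 + n1) + ((θ 1 : ℝ) : ℂ) • (((stagSign y : ℝ) : ℂ) • (n0 - n1)))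
  linarith

/-- Distinct sites give distinct orbitals of equal spin. [folklore] -/
private theorem orb_pt_ne' {Λ : Finset (Site d)} {x y : Site d} (hx : x ∈ Λ) (hy : y ∈ Λ) (hxy : x ≠ y) (σ : Fin 2) :
    orb (PolySite.pt x hx) σ ≠ orb (PolySite.pt y hy) σ := by
  intro h
  have h1 := (orb_inj.1 h).1
  have h2 := congrArg (fun p : PolySite Λ => ofLex p.1) h1
  simp only [PolySite.ofLex_coe_pt] at h2
  exact hxy h2

/-- On bonds only the hopping survives: `Φ{y, y+e_i} = Φ^{t,U}{y, y+e_i}`. [cite: arXiv9311033, §2 (the Hubbard Hamiltonian)] -/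
theorem hubbardStaggered_apply_pair (y : Site d) (i : Fin d) :
    (hubbardStaggered d t U θ).Φ {y, y + unitVec i} = (hubbardFermionInteraction d t U).Φ {y, y + unitVec i} := by
  have hne : ∀ z : Site d, ({y, y + unitVec i} : Finset (Site d)) ≠ {z} := by
    intro z h
    have := congrArg Finset.card h
    rw [card_pair (self_ne_add_unitVec y i), card_singleton] at this
    exact absurd this (by norm_num)
  rw [hubbardStaggered, FermionInteraction.linearFamily_apply, Fin.sum_univ_two, Matrix.cons_val_zero, Matrix.cons_val_one, Matrix.cons_val_zero,
    numberInteraction_apply_eq_zero hne, staggeredSpinInteraction_apply_eq_zero hne, smul_zero, smul_zero, add_zero, add_zero]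

/-- **Bond norm**: `‖Φ{y, y+e_i}‖ ≤ 2|t|` (Koma–Tasaki). [cite: KomaTasakiPRL1992, eq. (11) remark] -/
theorem norm_hubbardStaggered_pair_le (y : Site d) (i : Fin d) : ‖(hubbardStaggered d t U θ).Φ {y, y + unitVec i}‖ ≤ 2 * |t| := by
  rw [hubbardStaggered_apply_pair, hubbardFermionInteraction_apply_pair]
  exact norm_hoppingTerm_le_two_mul t (fun σ => orb (PolySite.pt y (mem_insert_self _ _)) σ)
    (fun σ => orb (PolySite.pt (y + unitVec i) (mem_insert_of_mem (mem_singleton_self _))) σ)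
    fun σ => orb_pt_ne' _ _ (self_ne_add_unitVec y i) σ

/-- **Numeric site norm of the staggered-field Hubbard model**: `Σ_{X ⊆ T, x ∈ X} ‖Φ X‖ ≤ |U| + 2|θ₀| + 2|θ₁| + 4d|t|` (any region, any site).
[cite: Israel1979, Lemma II.3.1] -/
theorem sum_norm_hubbardStaggered_le (T : Finset (Site d)) (x : Site d) :
    ∑ X ∈ T.powerset with x ∈ X, ‖(hubbardStaggered d t U θ).Φ X‖ ≤ |U| + 2 * |θ 0| + 2 * |θ 1| + 4 * d * |t| := by
  have h := sum_norm_le_of_nearestNeighbour (Ψ := hubbardStaggered d t U θ) (A := |U| + 2 * |θ 0| + 2 * |θ 1|) (B := 2 * |t|)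
    (by positivity) (by positivity) (fun X h1 h2 => hubbardStaggered_apply_eq_zero t U θ h1 h2) (norm_hubbardStaggered_singleton_le t U θ)
    (norm_hubbardStaggered_pair_le t U θ) T x
  linarith

/-- **`S_q(hubbardStaggered) ≤ |U| + 2|θ₀| + 2|θ₁| + 4d|t|`** for every superlattice `q` and range parameter `R`. [cite: Israel1979, Lemma II.3.1] -/
theorem cellSiteNorm_hubbardStaggered_le (q : Fin d → ℕ) (R : ℝ) :
    (hubbardStaggered d t U θ).cellSiteNorm q R ≤ |U| + 2 * |θ 0| + 2 * |θ 1| + 4 * d * |t| := by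
  unfold FermionInteraction.cellSiteNorm
  exact Finset.sup'_le _ _ fun c _ => sum_norm_hubbardStaggered_le t U θ _ _

end Staggered

/-- Cell site norms are non-negative. [cite: Israel1979, Lemma II.3.1] -/
theorem FermionInteraction.cellSiteNorm_nonneg (q : Fin d → ℕ) (Ψ : FermionInteraction d) (R : ℝ) : 0 ≤ Ψ.cellSiteNorm q R := by
  unfold FermionInteraction.cellSiteNorm
  exact le_trans (Finset.sum_nonneg fun X _ => norm_nonneg _)
    (Finset.le_sup' (fun c : Cell q => ∑ X ∈ (thicken ({cellPos c} : Finset (Site d)) R).powerset with cellPos c ∈ X, ‖Ψ.Φ X‖)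
      (Finset.mem_univ (fun i => (0 : Fin (q i + 1)))))

/-! ### §3. The fully numeric staggered-order certificate -/

namespace InfVolFermionState

variable {β t U a : ℝ} {ω : InfVolFermionState d}

/-- **FULLY NUMERIC STAGGERED-ORDER CERTIFICATE**: for every `(2ℤ)^d`-periodic equilibrium state `ω` of the zero-field Hubbard model
(`β > 0`, `d ≥ 1`), every `δ > 0`, every even `N ≥ 1` and certified `ℓ₀ ≤ log Re Z_N(a,0)`, `log Re Z_N(a,δ) ≤ u₁`:
`|m_s(ω)| ≤ ((u₁ − ℓ₀) + |β|((N+2)^d − N^d)(2|U| + 4|a| + 2δ + 8d|t|)) / (N^d βδ)`.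
[cite: Griffiths1964, Eq. (39) and Fig. 3] [cite: Israel1979, Lemma II.3.1] -/
theorem IsPerVarEquilibrium.abs_staggeredMagnetisation_le_numeric (hd : 0 < d) (hβ : 0 < β)
    (h : ω.IsPerVarEquilibrium β (evenPeriods d) (hubbardStaggered d t U ![a, 0]) 1) {δ : ℝ} (hδ : 0 < δ) {N : ℕ} (hN : 1 ≤ N) (hN2 : 2 ∣ N)
    {ℓ₀ u₁ : ℝ} (hℓ : ℓ₀ ≤ Real.log (Matrix.partitionFn β ((hubbardStaggered d t U ![a, 0]).localHamiltonian (halfOpenBox d N))).re)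
    (hu : Real.log (Matrix.partitionFn β ((hubbardStaggered d t U ![a, δ]).localHamiltonian (halfOpenBox d N))).re ≤ u₁) :
    |ω.staggeredMagnetisation| ≤
      ((u₁ - ℓ₀) + |β| * ((((N + 2) ^ d - N ^ d : ℕ) : ℝ) * (2 * |U| + 4 * |a| + 2 * δ + 8 * d * |t|))) / ((N : ℝ) ^ d * (β * δ)) := by
  have h0 := h.abs_staggeredMagnetisation_le_of_evenBoxes hd hβ hδ hN hN2 hℓ hu
  have hNd : (0 : ℝ) < (N : ℝ) ^ d := by positivity
  have hβδ : 0 < β * δ := mul_pos hβ hδ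
  -- numeric majorants of the collar and of the two site norms
  have hcol : (((thicken (halfOpenBox d N) 1 \ halfOpenBox d N).card : ℕ) : ℝ) ≤ (((N + 2) ^ d - N ^ d : ℕ) : ℝ) := by
    have h1 := card_thicken_halfOpenBox_sdiff_le (d := d) N (1 : ℝ)
    rw [Nat.floor_one, mul_one] at h1
    exact_mod_cast h1
  have hS0 := cellSiteNorm_hubbardStaggered_le (d := d) t U ![a, 0] (evenPeriods d) 1
  have hS1 := cellSiteNorm_hubbardStaggered_le (d := d) t U ![a, δ] (evenPeriods d) 1
  simp only [Matrix.cons_val_zero, Matrix.cons_val_one, abs_zero, mul_zero, add_zero] at hS0 hS1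
  rw [abs_of_pos hδ] at hS1
  have hS0nn := (hubbardStaggered d t U ![a, 0]).cellSiteNorm_nonneg (evenPeriods d) 1
  have hS1nn := (hubbardStaggered d t U ![a, δ]).cellSiteNorm_nonneg (evenPeriods d) 1
  have hprod : (((thicken (halfOpenBox d N) 1 \ halfOpenBox d N).card : ℕ) : ℝ) *
      ((hubbardStaggered d t U ![a, 0]).cellSiteNorm (evenPeriods d) 1 + (hubbardStaggered d t U ![a, δ]).cellSiteNorm (evenPeriods d) 1) ≤
      (((N + 2) ^ d - N ^ d : ℕ) : ℝ) * (2 * |U| + 4 * |a| + 2 * δ + 8 * d * |t|) :=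
    mul_le_mul hcol (by linarith) (add_nonneg hS0nn hS1nn) (Nat.cast_nonneg _)
  refine h0.trans ?_
  rw [← add_div, div_div]
  refine div_le_div_of_nonneg_right ?_ (by positivity)
  have := mul_le_mul_of_nonneg_left hprod (abs_nonneg β)
  linarith

end InfVolFermionState

end Literature.MathematicalPhysics.QuantumLattice

end
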